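import Summits.ValiantsHypothesis.ValiantsHypothesis.Theses.LangWeilTransfer
import Summits.ValiantsHypothesis.ValiantsHypothesis.Theorems.LangWeilTransferTransferGlueAlgebra
import Summits.ValiantsHypothesis.ValiantsHypothesis.Theorems.LangWeilTransferTransferGluePrimes
import Summits.ValiantsHypothesis.ValiantsHypothesis.Theorems.LangWeilTransferTransferGlueBounds

/-!
# LangWeilTransfer, support item `TransferGlue` (stmt-ValiantsHypothesis-6379) — PROVED

Route `LangWeilTransfer` of `ValiantsHypothesis`, support item `TransferGlue`:
`LangWeilBound → GoodReduction → TameResolution → TameTransfer` (Theorem T of the route from its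
three effective-arithmetic inputs). Proof, following the item text and the refuters' audit
(g41-11, g41-12): resolve the tame minimal prime `𝔭` by `TameResolution` (`Q`, `ρ`, `V`, `cQ`);
transfer the `ℚ̄`-pointwise implication "`Q = 0 ∧ ρ ≠ 0 ⇒ S(V/ρ) = 0`" to integer identities
`C cQ^k · (ρ' P_i)^N = Q · H_i` (`exists_C_pow_mul_pow_eq_mul`, Nullstellensatz + pseudo-division);
apply `GoodReduction` to `Q` with `f := B`; pick a prime `p` above `max(2^T, Lang–Weil threshold)`
outside GoodReduction's exceptional set and not dividing `cQ` nor one fixed nonzero coefficient of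
`ρ`, of bit-size `O(log(threshold + #bad))` (`exists_prime_gt_notMem_le`, Chebyshev); over
`K = GaloisField p f'` (no field extension needed: `p` itself exceeds the Lang–Weil threshold) the
absolutely irreducible factor `Q₁ ∣ Q̄` does not divide `G := ρ̄'` (`not_dvd_of_dvd_map`), so
`LangWeilBound` yields `x` with `Q₁(x) = 0 ≠ ρ̄'(x)`, and `z := V̄(x)/ρ̄'(x)` solves `S` in `K` by the
integer identities reduced mod `p`. The size bound `p^{f'} ≤ 2^{β^a}`,
`β = B+T+m+log d+log log w+log t+2`, holds with `a = 24(a₁+1)(a₂+a₃+1)+3` (`a₁, a₂, a₃` the exponents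
of the three inputs; `final_bound`). Honest framing: bookkeeping inside a dormant route whose cruxes
(`ShatteringExclusion`, `TameTransfer`'s inputs `TameResolution`/`LangWeilBound`/`GoodReduction`)
remain open or unformalised; nothing here bears on VP ≠ VNP.
-/

noncomputable section

open MvPolynomial

-- the summit and the problem share the name `ValiantsHypothesis` (D-0017 single-conjunct layout)
set_option linter.dupNamespace false

namespace Summit.ValiantsHypothesis.ValiantsHypothesis.Theorems.LangWeilTransfer

open Literature.Computability.AlgebraicComplexity (weight)
open Summit.ValiantsHypothesis.ValiantsHypothesis.Theses.LangWeilTransfer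

/-- The geometric component count of the resolved hypersurface `Q` is positive: `Q ⊗ ℚ̄` is a
non-unit (positive `U`-degree), so `(Q) ≠ ⊤` has a minimal prime, and finitely many (Noetherian). -/
theorem ncard_minimalPrimes_pos {r : ℕ} {Q : MvPolynomial (Fin (r + 1)) ℤ} {cQ : ℤ} (hcQ : cQ ≠ 0)
    (hlc : (finSuccEquiv ℤ r Q).leadingCoeff = C cQ) (hdeg : 0 < (finSuccEquiv ℤ r Q).natDegree) :
    0 < ((Ideal.map (MvPolynomial.map (algebraMap ℚ (AlgebraicClosure ℚ)))
      (Ideal.span {MvPolynomial.map (Int.castRingHom ℚ) Q})).minimalPrimes).ncard := by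
  have hcomp : (algebraMap ℚ (AlgebraicClosure ℚ)).comp (Int.castRingHom ℚ) =
      Int.castRingHom (AlgebraicClosure ℚ) := RingHom.ext_int _ _
  have hmap : Ideal.map (MvPolynomial.map (algebraMap ℚ (AlgebraicClosure ℚ)))
        (Ideal.span {MvPolynomial.map (Int.castRingHom ℚ) Q}) =
      Ideal.span {MvPolynomial.map (Int.castRingHom (AlgebraicClosure ℚ)) Q} := by
    rw [Ideal.map_span, Set.image_singleton, map_map, hcomp]
  rw [hmap]
  have hcQL : (cQ : AlgebraicClosure ℚ) ≠ 0 := by exact_mod_cast hcQ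
  have hne : Ideal.span {MvPolynomial.map (Int.castRingHom (AlgebraicClosure ℚ)) Q} ≠ ⊤ :=
    fun h => not_isUnit_map hlc hdeg hcQL (Ideal.span_singleton_eq_top.mp h)
  obtain ⟨⟨P, hP⟩⟩ := Ideal.nonempty_minimalPrimes hne
  exact (Set.ncard_pos (Ideal.finite_minimalPrimes_of_isNoetherianRing _ _)).mpr ⟨P, hP⟩

/-- `finSuccEquiv (rename Fin.succ q) = C q`: a polynomial in the variables `X_1..X_r` only is a
constant in `X_0`. -/
theorem finSuccEquiv_rename_succ_eq_C {R : Type*} [CommSemiring R] {r : ℕ} (q : MvPolynomial (Fin r) R) :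
    finSuccEquiv R r (rename Fin.succ q) = Polynomial.C q := by
  induction q using MvPolynomial.induction_on with
  | C a => rw [rename_C]; simp [finSuccEquiv_apply]
  | add p q hp hq => rw [map_add, map_add, hp, hq, map_add]
  | mul_X p i hp => rw [map_mul, map_mul, hp, rename_X, finSuccEquiv_X_succ, map_mul]

/-- **`TransferGlue`** (stmt-ValiantsHypothesis-6379): `LangWeilBound → GoodReduction →
TameResolution → TameTransfer`. -/
theorem transferGlue_proof :
    Summit.ValiantsHypothesis.ValiantsHypothesis.Theses.LangWeilTransfer.TransferGlue := by
  intro hLW hGR hTR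
  obtain ⟨a₃, hLW⟩ := hLW
  obtain ⟨a₂, hGR⟩ := hGR
  obtain ⟨a₁, hTR⟩ := hTR
  refine ⟨24 * (a₁ + 1) * (a₂ + a₃ + 1) + 3, ?_⟩
  intro m t d w B T S hSd hSw h𝔭
  obtain ⟨𝔭, h𝔭, -, h𝔭B⟩ := h𝔭
  obtain ⟨r, Q, ρ, V, cQ, hr, hcQ, hρ, hlc, hdeg, hirr, hcomp, himp, hQd, hρd, -, hQw, hρw, -⟩ :=
    hTR m t d w S hSd hSw 𝔭 h𝔭
  classical
  set Δ := (d + 2) ^ (a₁ * (m + 1)) with hΔ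
  set Λ := (Nat.log 2 w + Nat.log 2 t + 2) ^ a₁ with hΛ
  set ρ' : MvPolynomial (Fin (r + 1)) ℤ := rename Fin.succ ρ with hρ'
  have hρ'eval : ∀ {A : Type} [CommRing A] [Algebra ℤ A] (x : Fin (r + 1) → A),
      aeval x ρ' = aeval (x ∘ Fin.succ) ρ := fun x => by rw [hρ', aeval_rename]
  -- (1) cleared numerators `P i = ρ'^{D i} · S_i(V/ρ')`
  choose D P hP using fun i => exists_cleared V ρ' (S i)
  -- `hP` at an arbitrary `ℤ`-algebra structure (all `ℤ`-algebra structures on a ring coincide)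
  have hPat : ∀ (A : Type) [Field A] [inst : Algebra ℤ A] (i : Fin t) (x : Fin (r + 1) → A),
      aeval x ρ' ≠ 0 →
        aeval x (P i) = aeval x ρ' ^ D i * aeval (fun j => aeval x (V j) / aeval x ρ') (S i) := by
    intro A _ inst i x
    obtain rfl : (Ring.toIntAlgebra A : Algebra ℤ A) = inst := Subsingleton.elim _ _
    exact hP i A x
  -- (2) integer identities `C cQ^k · (ρ' P_i)^N = Q · H_i`
  have hid : ∀ i, ∃ (N k : ℕ) (H : MvPolynomial (Fin (r + 1)) ℤ), 0 < N ∧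
      C (cQ ^ k) * (ρ' * P i) ^ N = Q * H := by
    intro i
    refine exists_C_pow_mul_pow_eq_mul Q (ρ' * P i) hcQ hlc hdeg fun x hxQ => ?_
    rw [map_mul]
    by_cases hxρ : aeval x ρ' = 0
    · rw [hxρ, zero_mul]
    · rw [hPat (AlgebraicClosure ℚ) i x hxρ]
      have hxρ2 : aeval (x ∘ Fin.succ) ρ ≠ 0 := by rwa [← hρ'eval]
      have h0 := himp x hxQ hxρ2 i
      simp_rw [← hρ'eval] at h0
      rw [h0, mul_zero, mul_zero]
  choose N k H hN hId using hid
  -- (3) GoodReduction for `Q`, `f := B`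
  obtain ⟨bad, hbad, hgood⟩ := hGR r B Q hirr (ncard_minimalPrimes_pos hcQ hlc hdeg) (hcomp.trans h𝔭B)
  -- (4) a nonzero coefficient of `ρ`; `cQ` is a coefficient of `Q`
  obtain ⟨n₀, hn₀⟩ := MvPolynomial.ne_zero_iff.mp hρ
  have hcQcoeff : cQ = coeff (Finsupp.cons (finSuccEquiv ℤ r Q).natDegree 0) Q := by
    have := congr_arg (coeff (0 : Fin r →₀ ℕ)) hlc
    rwa [coeff_C, if_pos rfl, Polynomial.leadingCoeff, finSuccEquiv_coeff_coeff, eq_comm] at this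
  -- (5) the prime
  set X₀ := max (2 ^ T) (a₃ * (Δ + 1) ^ a₃ * (Δ + 1) ^ a₃) with hX₀
  set bad' := bad ∪ cQ.natAbs.primeFactors ∪ (coeff n₀ ρ).natAbs.primeFactors with hbad'
  obtain ⟨p, hp, hpX, hpbad, hple⟩ := exists_prime_gt_notMem_le X₀ bad'
  haveI hpF : Fact p.Prime := ⟨hp⟩
  have hpbad1 : p ∉ bad := fun h => hpbad (by rw [hbad']; simp [h])
  have hpcQ : ¬ p ∣ cQ.natAbs := fun h =>
    hpbad (by rw [hbad']; simp [Nat.mem_primeFactors, hp, h, hcQ])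
  have hpn₀ : ¬ p ∣ (coeff n₀ ρ).natAbs := fun h =>
    hpbad (by rw [hbad']; simp [Nat.mem_primeFactors, hp, h, hn₀])
  -- (6) good reduction at `p`; the finite field `K = GaloisField p f'`
  obtain ⟨f', hf'pos, hf'B, Q₁, hQ₁irr, hQ₁dvd⟩ := hgood p hpbad1
  haveI : Fintype (GaloisField p f') := Fintype.ofFinite _
  have hcQF : (cQ : GaloisField p f') ≠ 0 := by
    rw [Ne, CharP.intCast_eq_zero_iff (GaloisField p f') p, Int.natCast_dvd]; exact hpcQ
  have hn₀F : ((coeff n₀ ρ : ℤ) : GaloisField p f') ≠ 0 := by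
    rw [Ne, CharP.intCast_eq_zero_iff (GaloisField p f') p, Int.natCast_dvd]; exact hpn₀
  have halg : algebraMap ℤ (GaloisField p f') = Int.castRingHom _ := RingHom.ext_int _ _
  rw [halg] at hQ₁dvd
  set G : MvPolynomial (Fin (r + 1)) (GaloisField p f') :=
    MvPolynomial.map (Int.castRingHom _) ρ' with hG
  set g : MvPolynomial (Fin r) (GaloisField p f') := MvPolynomial.map (Int.castRingHom _) ρ with hg
  have hg0 : g ≠ 0 := by
    intro h0
    have := congr_arg (coeff n₀) h0
    rw [hg, coeff_map, coeff_zero, eq_intCast] at this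
    exact hn₀F this
  have hGg : finSuccEquiv (GaloisField p f') r G = Polynomial.C g := by
    rw [hG, hρ', map_rename, ← hg, finSuccEquiv_rename_succ_eq_C]
  have hQ₁nu : ¬ IsUnit Q₁ := fun hu => hQ₁irr.not_isUnit (hu.map _)
  have hndvd : ¬ Q₁ ∣ G := not_dvd_of_dvd_map hlc hcQF hQ₁nu hQ₁dvd hg0 hGg
  -- degrees: `deg Q₁ ≤ deg Q ≤ Δ`, `deg G ≤ deg ρ ≤ Δ`
  have hmapdeg : ∀ {σ : Type} (q : MvPolynomial σ ℤ),
      (MvPolynomial.map (Int.castRingHom (GaloisField p f')) q).totalDegree ≤ q.totalDegree :=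
    fun q => Finset.sup_mono (support_map_subset _ _)
  have hQF0 : MvPolynomial.map (Int.castRingHom (GaloisField p f')) Q ≠ 0 := by
    intro h0
    have h1 := (natDegree_leadingCoeff_map hlc hcQF).1
    rw [h0, map_zero, Polynomial.natDegree_zero] at h1
    omega
  have hQ₁deg : Q₁.totalDegree ≤ Δ := by
    obtain ⟨Hq, hHq⟩ := hQ₁dvd
    have hQ₁0 : Q₁ ≠ 0 := by rintro rfl; exact hQF0 (by rw [hHq, zero_mul])
    have hHq0 : Hq ≠ 0 := by rintro rfl; exact hQF0 (by rw [hHq, mul_zero])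
    have := totalDegree_mul_of_isDomain hQ₁0 hHq0
    have h2 := hmapdeg Q
    rw [hHq, this] at h2
    omega
  have hGdeg : G.totalDegree ≤ Δ :=
    ((hmapdeg ρ').trans ((totalDegree_rename_le _ _).trans hρd))
  have hcardF : Fintype.card (GaloisField p f') = p ^ f' := by
    rw [Fintype.card_eq_nat_card, GaloisField.card p f' hf'pos.ne']
  have hLWhyp : a₃ * (Q₁.totalDegree + 1) ^ a₃ * (G.totalDegree + 1) ^ a₃ <
      Fintype.card (GaloisField p f') := by
    calc a₃ * (Q₁.totalDegree + 1) ^ a₃ * (G.totalDegree + 1) ^ a₃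
        ≤ a₃ * (Δ + 1) ^ a₃ * (Δ + 1) ^ a₃ := by gcongr
      _ ≤ X₀ := le_max_right _ _
      _ < p := hpX
      _ ≤ p ^ f' := Nat.le_self_pow hf'pos.ne' p
      _ = Fintype.card (GaloisField p f') := hcardF.symm
  -- (7) the Lang–Weil point
  obtain ⟨x, hxQ₁, hxG⟩ := hLW (GaloisField p f') r Q₁ G hQ₁irr hndvd hLWhyp
  have haeval : ∀ q : MvPolynomial (Fin (r + 1)) ℤ,
      aeval x q = eval x (MvPolynomial.map (Int.castRingHom (GaloisField p f')) q) := fun q => by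
    rw [eval_map, aeval_def, halg]
  have hxρ' : aeval x ρ' ≠ 0 := by
    intro h0; apply hxG
    change eval x G = 0
    rw [hG, ← haeval, h0]
  have hxQ : aeval x Q = 0 := by
    obtain ⟨Hq, hHq⟩ := hQ₁dvd
    rw [haeval, hHq, map_mul]
    change aeval x Q₁ * eval x Hq = 0
    rw [hxQ₁, zero_mul]
  -- (8) the witnesses
  refine ⟨p, f', hpF, lt_of_le_of_lt (le_max_left _ _) hpX, hf'pos, ?_,
    fun j => aeval x (V j) / aeval x ρ', fun i => ?_⟩
  · -- the size bound
    have hc₁ : cQ.natAbs.primeFactors.card ≤ Δ * Λ := by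
      refine (Literature.NumberTheory.Sieve.BombieriSieve.card_primeFactors_le_log _).trans
        ((Nat.log_mono_right ?_).trans hQw)
      rw [hcQcoeff]
      exact Finset.single_le_sum (f := fun n => (coeff n Q).natAbs) (fun _ _ => Nat.zero_le _)
        (mem_support_iff.mpr (by rw [← hcQcoeff]; exact hcQ))
    have hc₂ : (coeff n₀ ρ).natAbs.primeFactors.card ≤ Δ * Λ := by
      refine (Literature.NumberTheory.Sieve.BombieriSieve.card_primeFactors_le_log _).trans
        ((Nat.log_mono_right ?_).trans hρw)
      exact Finset.single_le_sum (f := fun n => (coeff n ρ).natAbs) (fun _ _ => Nat.zero_le _)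
        (mem_support_iff.mpr hn₀)
    have hbad'card : bad'.card ≤ bad.card + cQ.natAbs.primeFactors.card +
        (coeff n₀ ρ).natAbs.primeFactors.card := by
      rw [hbad']
      exact (Finset.card_union_le _ _).trans (Nat.add_le_add_right (Finset.card_union_le _ _) _)
    have hX₀le : X₀ ≤ 2 ^ T + a₃ * (Δ + 1) ^ a₃ * (Δ + 1) ^ a₃ :=
      max_le (Nat.le_add_right _ _) (Nat.le_add_left _ _)
    refine final_bound hp.two_le hf'B hr hQd hQw hc₁ hc₂ hbad hX₀le ?_
    refine hple.trans (Nat.pow_le_pow_right two_pos ?_)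
    have := Nat.log_mono_right (b := 2) (show X₀ + bad'.card + 2 ≤
      X₀ + (bad.card + cQ.natAbs.primeFactors.card + (coeff n₀ ρ).natAbs.primeFactors.card) + 2 by omega)
    omega
  · -- `S_i(z) = 0`
    have h1 : (aeval x (C (cQ ^ k i)) : GaloisField p f') * (aeval x ρ' * aeval x (P i)) ^ N i =
        aeval x Q * aeval x (H i) := by
      rw [← map_mul, ← map_pow, ← map_mul, hId i, map_mul]
    have hC : (aeval x (C (cQ ^ k i)) : GaloisField p f') ≠ 0 := by
      rw [aeval_C, eq_intCast, Int.cast_pow]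
      exact pow_ne_zero _ hcQF
    rw [hxQ, zero_mul] at h1
    have h2 : aeval x (P i) = 0 := by
      rcases mul_eq_zero.mp h1 with h | h
      · exact absurd h hC
      · rcases mul_eq_zero.mp ((pow_eq_zero_iff (hN i).ne').mp h) with h' | h'
        · exact absurd h' hxρ'
        · exact h'
    have h3 := hPat (GaloisField p f') i x hxρ'
    rw [h2] at h3
    rcases mul_eq_zero.mp h3.symm with h | h
    · exact absurd h (pow_ne_zero _ hxρ')
    · exact h

end Summit.ValiantsHypothesis.ValiantsHypothesis.Theorems.LangWeilTransfer
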